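import Mathlib

/-!
# Route BarrierLever — item `PartitionMinorsHitByVP` (stmt-ValiantsHypothesis-19717), part 1/3:
# the MAX-PLUS tropical lemma for matrices of sums of powers

Helper file (`--supports stmt-ValiantsHypothesis-19717`; cell valiant-natproofs, rung V4, 𝒟-side,
prover seat val-np-p3). Mathlib only. Closes NO item.

**Theorem (`det_sumPow_ne_zero_of_unique_max`).** Let `A[i,j] = Σ_{k < m} X^{e k i j} ∈ ℂ[X]`
(`m ≥ 1`) and `cost σ = Σ_j max_k e k (σ j) j` (Mathlib's Leibniz orientation `(σ j, j)`). If `σ₀`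
is the UNIQUE maximiser of `cost`, then `det A ≠ 0`: every Leibniz term `∏_j A (σ j) j` has degree
`≤ cost σ`, with equality and leading coefficient a product of POSITIVE INTEGERS (the multiplicities
`#{k : e k (σ j) j = max}`), so the coefficient of `X^{cost σ₀}` in `det A` is `± ∏ (multiplicities)
≠ 0`. This is the isolation mechanism (unique optimum ⇒ nonvanishing leading term) for the
"max over experts of additive scores" certificates used by the product-state witnesses of parts 2–3
(`…ProductStates`, `…ProductStateSums`).

WHAT THIS IS NOT: nothing layout-specific; no item is touched here.

References: Mulmuley–Vazirani–Vazirani 1987 / Klivans–Spielman 2001 (isolation: a unique optimal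
assignment isolates the top coefficient of a determinant); [Burgisser2000] §4 (degeneration arguments).
-/

set_option linter.dupNamespace false

namespace Summit.ValiantsHypothesis.ValiantsHypothesis.Theorems.BarrierLever.ProductStateSums

open Finset

noncomputable section

section Tropical

open Polynomial

variable {m : ℕ}

/-- `Σ_k X^{e k}` has degree at most `max_k e k`. -/
theorem natDegree_sum_X_pow_le (e : Fin m → ℕ) :
    (∑ k, (X : ℂ[X]) ^ e k).natDegree ≤ univ.sup e := by
  apply natDegree_sum_le_of_forall_le
  intro k hk
  rw [natDegree_X_pow]
  exact Finset.le_sup hk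

/-- For `m ≥ 1` the coefficient of `Σ_k X^{e k}` at `max_k e k` is a positive integer. -/
theorem coeff_sum_X_pow_sup_ne_zero (hm : 0 < m) (e : Fin m → ℕ) :
    (∑ k, (X : ℂ[X]) ^ e k).coeff (univ.sup e) ≠ 0 := by
  rw [finsetSum_coeff]
  simp only [coeff_X_pow]
  rw [Finset.sum_boole, Nat.cast_ne_zero, ← Nat.pos_iff_ne_zero, Finset.card_pos]
  have hne : (univ : Finset (Fin m)).Nonempty := ⟨⟨0, hm⟩, mem_univ _⟩
  obtain ⟨k, -, hk'⟩ := Finset.exists_mem_eq_sup univ hne e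
  exact ⟨k, by simp [hk']⟩

/-- For `m ≥ 1`, `Σ_k X^{e k}` has degree exactly `max_k e k`. -/
theorem natDegree_sum_X_pow (hm : 0 < m) (e : Fin m → ℕ) :
    (∑ k, (X : ℂ[X]) ^ e k).natDegree = univ.sup e :=
  le_antisymm (natDegree_sum_X_pow_le e) (le_natDegree_of_ne_zero (coeff_sum_X_pow_sup_ne_zero hm e))

/-- For `m ≥ 1`, `Σ_k X^{e k} ≠ 0`. -/
theorem sum_X_pow_ne_zero (hm : 0 < m) (e : Fin m → ℕ) : (∑ k, (X : ℂ[X]) ^ e k) ≠ 0 := by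
  intro h0
  have := coeff_sum_X_pow_sup_ne_zero hm e
  rw [h0, coeff_zero] at this
  exact this rfl

/-- **Tropical lemma (sums of powers).** Let `A[i,j] = Σ_k X^{e k i j}` (`m ≥ 1` terms) and put
`cost σ = Σ_j max_k e k (σ j) j`. If `σ₀` is the UNIQUE maximiser of `cost`, then `det A ≠ 0`:
the coefficient of `X^{cost σ₀}` in `det A` is `sign σ₀ · ∏_j #{k : e k (σ₀ j) j is maximal} ≠ 0`. -/
theorem det_sumPow_ne_zero_of_unique_max {r : ℕ} (hm : 0 < m) (e : Fin m → Fin r → Fin r → ℕ)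
    (σ₀ : Equiv.Perm (Fin r))
    (huniq : ∀ σ : Equiv.Perm (Fin r), σ ≠ σ₀ →
      ∑ j, univ.sup (fun k => e k (σ j) j) < ∑ j, univ.sup (fun k => e k (σ₀ j) j)) :
    (Matrix.of fun i j : Fin r => ∑ k, (X : ℂ[X]) ^ e k i j).det ≠ 0 := by
  set A : Matrix (Fin r) (Fin r) ℂ[X] := Matrix.of fun i j : Fin r => ∑ k, (X : ℂ[X]) ^ e k i j
    with hA
  set N : ℕ := ∑ j, univ.sup (fun k => e k (σ₀ j) j) with hN
  have hPdeg : ∀ σ : Equiv.Perm (Fin r),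
      (∏ j, A (σ j) j).natDegree ≤ ∑ j, univ.sup (fun k => e k (σ j) j) := by
    intro σ
    refine (natDegree_prod_le _ _).trans (Finset.sum_le_sum fun j _ => ?_)
    simp only [hA, Matrix.of_apply]
    exact natDegree_sum_X_pow_le _
  have hfac : ∀ j ∈ (univ : Finset (Fin r)), A (σ₀ j) j ≠ 0 := fun j _ => by
    simp only [hA, Matrix.of_apply]; exact sum_X_pow_ne_zero hm _
  have hP0 : (∏ j, A (σ₀ j) j).coeff N ≠ 0 := by
    have hdeg : (∏ j, A (σ₀ j) j).natDegree = N := by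
      rw [natDegree_prod _ _ hfac]
      refine Finset.sum_congr rfl fun j _ => ?_
      simp only [hA, Matrix.of_apply]
      exact natDegree_sum_X_pow hm _
    rw [← hdeg, coeff_natDegree, leadingCoeff_ne_zero]
    exact Finset.prod_ne_zero_iff.mpr hfac
  have hPσ : ∀ σ : Equiv.Perm (Fin r), σ ≠ σ₀ → (∏ j, A (σ j) j).coeff N = 0 := fun σ hσ =>
    coeff_eq_zero_of_natDegree_lt ((hPdeg σ).trans_lt (huniq σ hσ))
  have hterm : ∀ σ : Equiv.Perm (Fin r),
      ((((Equiv.Perm.sign σ : ℤˣ) : ℤ) : ℂ[X]) * ∏ j, A (σ j) j).coeff N =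
        (((Equiv.Perm.sign σ : ℤˣ) : ℤ) : ℂ) * (∏ j, A (σ j) j).coeff N := by
    intro σ
    rw [← C_eq_intCast, coeff_C_mul]
  -- the coefficient of `X^N` in `det A`
  intro hdet
  have hcoeff : (A.det).coeff N = 0 := by rw [hdet, coeff_zero]
  rw [Matrix.det_apply', finsetSum_coeff, Finset.sum_eq_single σ₀, hterm] at hcoeff
  · refine mul_ne_zero ?_ hP0 hcoeff
    exact Int.cast_ne_zero.mpr (Units.ne_zero _)
  · intro σ _ hσ
    rw [hterm, hPσ σ hσ, mul_zero]
  · intro h; exact absurd (mem_univ σ₀) h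

end Tropical

end

end Summit.ValiantsHypothesis.ValiantsHypothesis.Theorems.BarrierLever.ProductStateSums
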